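import Literature.NumberTheory.Sieve.QuadraticRootsLevelUnfold
import Literature.NumberTheory.Sieve.QuadraticRootsLevelGeometry
import HarnessLib

/-!
# The Weyl sum over Heegner points of level `q` as values of a Poincaré series (DFI 1995 (14), `Δ < 0`)

Topic `Literature/NumberTheory/Sieve`.  The identity (14) p. 428 of W. Duke, J. B. Friedlander,
H. Iwaniec, *Equidistribution of roots of a quadratic congruence to prime moduli*, Ann. of Math.
141 (1995), in the tree's conventions (`QuadraticRootsLevelForms/…/Classes/…/Geometry`,
`QuadraticRootsTothWeylSum` for the `Γ₀(q)`-orbits `TRedOrbit`, `QuadraticRootsLevelUnfold` for the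
Poincaré series `RootForms.poincareFn q φ z = ∑_{σ ∈ Γ∞∖Γ₀(q)} φ(σ z)`): for a positive definite
form `R` (`A > 0`, `Δ < 0`) with Heegner point `z_R` and a `T`-invariant kernel `φ` on `ℍ`,

* `tsum_heegnerPt_TRedOrbit_eq` — **the orbit identity**
  `|stab_q(R)| · ∑'_{Q ∈ TRedOrbit R q} φ(z_Q) = 2 · P_φ(z_R)`
  (the map `(s, Q) ↦ Γ∞ (s ξ_Q)⁻¹`, `s ∈ stab_q(R)`, `R·ξ_Q = Q`, is a two-to-one surjection of
  `stab_q(R) × TRedOrbit R q` onto `Γ∞∖Γ₀(q)`, and `φ(σ_{Γ∞(sξ_Q)⁻¹} z_R) = φ(ξ_Q⁻¹ z_R) = φ(z_Q)`: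
  DFI's `|Γ_z|⁻¹ ∑_σ`, (13)–(14));
* `tsum_weylWeightSL_lift_eq_level` — the fibre of the Weyl sum over a `Γ₀(q)`-orbit
  representative, `q = ad` (the level-`q` version of `RootForms.tsum_weylWeightSL_lift_eq`);
* `norm_weylSum_le_card_mul` — **the assembly**: if `φ(z_Q) = w(Q)` (the Weyl weight) on level
  forms, then `|∑_{n ≤ N, d ∣ n} G(n) ρ_h(n)| ≤ 2 · #{orbits met} · sup_R |P_φ(z_R)|`;
* `exists_card_orbitReps_le` — the number of `Γ₀(q)`-orbits met is `≤ C(f) τ(q)` (DFI's remark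
  after (14), via `RootForms.card_le_of_levelCosets`);
* `heegnerPt_eq_smul_heegnerPt_rep`, `heegnerPt_mem_box_of_mem_classReps` — every `z_R` is an
  `SL₂(ℤ)`-translate of the Heegner point of a class representative, and these lie in a box
  depending only on `Δ`.

Everything here is proved; the statements are bookkeeping for the proof of DFI's Proposition 4
(`dukeFriedlanderIwaniec1995_proposition4`).

## References

* W. Duke, J. B. Friedlander, H. Iwaniec, Ann. of Math. (2) 141 (1995), 423–441, (13)–(14) p. 428
  and the remark after (14). [cite: DukeFriedlanderIwaniec1995, (13)–(14) p. 428]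
* H. Iwaniec, *Spectral Methods of Automorphic Forms*, GSM 53 (2002), §2.3 (the cosets `Γ∞∖Γ₀(q)`).
  [cite: Iwaniec2002, §2.3]
-/

noncomputable section

namespace Literature.NumberTheory.Sieve

open scoped MatrixGroups UpperHalfPlane
open Literature.NumberTheory.QuadraticFields.Quadratic (BinQF)
open UpperHalfPlane Polynomial
open ModularGroup (T)

namespace RootForms

variable {q : ℕ} {R : BinQF}

/-! ### Positive definite orbits -/

/-- Elements of the `Γ₀(q)`-orbit of a positive definite form have `A > 0`. [folklore] -/
theorem TRedOrbit.a_pos (hA : 0 < R.a) (hΔ : R.disc < 0) (Q : TRedOrbit R q) : 0 < Q.1.a := by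
  obtain ⟨γ, -, hγ⟩ := Q.2.2
  rw [← hγ]
  exact smul_a_pos_of_definite hA hΔ γ

/-- Elements of the orbit have the same discriminant. [folklore] -/
theorem TRedOrbit.disc_eq (Q : TRedOrbit R q) : Q.1.disc = R.disc := by
  obtain ⟨γ, -, hγ⟩ := Q.2.2
  rw [← hγ, smul_disc]

/-- Negative discriminant is preserved. [folklore] -/
theorem TRedOrbit.disc_neg (hΔ : R.disc < 0) (Q : TRedOrbit R q) : Q.1.disc < 0 := by
  rw [Q.disc_eq]; exact hΔ

/-- The Heegner point only depends on the form (proof-irrelevance helper). [folklore] -/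
theorem heegnerPt_congr {Q Q' : BinQF} (h : Q = Q') (hA : 0 < Q.a) (hΔ : Q.disc < 0)
    (hA' : 0 < Q'.a) (hΔ' : Q'.disc < 0) : heegnerPt Q hA hΔ = heegnerPt Q' hA' hΔ' := by
  subst h; rfl

/-- `stab_q(R)` of a positive definite form is finite. [cite: DukeFriedlanderIwaniec1995, §2 pp. 427–428 (`|Γ_z|`)] -/
theorem finite_stabLevel_of_definite (hA : 0 < R.a) (hΔ : R.disc < 0) (q : ℕ) :
    Finite (stabLevel R q) := by
  haveI := finite_stab_of_definite hA hΔ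
  exact Finite.of_injective (fun s : stabLevel R q => (⟨s.1, s.2.1⟩ : stab R))
    (fun s s' h => Subtype.ext (congrArg (fun y : stab R => (y : SL(2, ℤ))) h))

/-! ### A two-to-one counting lemma -/

/-- If `Θ : X → Y` is surjective and its fibres are exactly the pairs `{x, ι x}` (`ι x ≠ x`,
`Θ ∘ ι = Θ`), then for a function `F` on `Y` with `F ∘ Θ` finitely supported,
`∑' x, F (Θ x) = 2 ∑' y, F y`. [folklore] -/
theorem tsum_comp_eq_two_mul_tsum {X Y : Type*} (Θ : X → Y) (hsurj : Function.Surjective Θ)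
    (ι : X → X) (hι : ∀ x, Θ (ι x) = Θ x) (hιne : ∀ x, ι x ≠ x)
    (hfib : ∀ x x', Θ x' = Θ x → x' = x ∨ x' = ι x) (F : Y → ℂ)
    (hfin : (Function.support fun x => F (Θ x)).Finite) :
    ∑' x, F (Θ x) = 2 * ∑' y, F y := by
  classical
  set Sx : Finset X := hfin.toFinset with hSx
  set Sy : Finset Y := Sx.image Θ with hSy
  have hSx_mem : ∀ x, x ∈ Sx ↔ F (Θ x) ≠ 0 := fun x => by
    rw [hSx, Set.Finite.mem_toFinset, Function.mem_support]
  have hSy_of : ∀ y, F y ≠ 0 → y ∈ Sy := by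
    intro y hy
    obtain ⟨x, rfl⟩ := hsurj y
    exact Finset.mem_image_of_mem _ ((hSx_mem x).2 hy)
  rw [tsum_eq_sum (s := Sx) (fun x hx => by simpa [hSx_mem] using hx),
    tsum_eq_sum (s := Sy) (fun y hy => by by_contra h; exact hy (hSy_of y h)),
    ← Finset.sum_fiberwise_of_maps_to (g := Θ) (t := Sy) (fun x hx => Finset.mem_image_of_mem _ hx),
    Finset.mul_sum]
  refine Finset.sum_congr rfl fun y hy => ?_
  obtain ⟨x₀, hx₀, rfl⟩ := Finset.mem_image.1 hy
  have hfibre : Sx.filter (fun x => Θ x = Θ x₀) = {x₀, ι x₀} := by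
    ext x
    rw [Finset.mem_filter, Finset.mem_insert, Finset.mem_singleton]
    constructor
    · rintro ⟨-, hx⟩; exact hfib x₀ x hx
    · rintro (rfl | rfl)
      · exact ⟨hx₀, rfl⟩
      · refine ⟨(hSx_mem _).2 ?_, hι x₀⟩
        rw [hι]; exact (hSx_mem x₀).1 hx₀
  rw [Finset.sum_congr rfl (fun x hx => by rw [(Finset.mem_filter.1 hx).2]), Finset.sum_const, hfibre,
    Finset.card_pair (hιne x₀).symm, nsmul_eq_mul]
  norm_num

/-- A finitely supported sum over a product with a finite first factor, of a function of the
second variable. [folklore] -/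
theorem tsum_prod_snd_eq {A B : Type*} [Finite A] (g : B → ℂ) (hfin : (Function.support g).Finite) :
    ∑' x : A × B, g x.2 = Nat.card A * ∑' b, g b := by
  classical
  haveI : Fintype A := Fintype.ofFinite A
  set Sb : Finset B := hfin.toFinset
  have hSb : ∀ b, b ∉ Sb → g b = 0 := fun b hb => by simpa [Sb] using hb
  rw [tsum_eq_sum (s := (Finset.univ : Finset A) ×ˢ Sb) (fun x hx => by
      apply hSb; intro h; exact hx (Finset.mem_product.2 ⟨Finset.mem_univ _, h⟩)),
    tsum_eq_sum (s := Sb) (fun b hb => hSb b hb), Finset.sum_product]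
  dsimp only
  rw [Finset.sum_const, Finset.card_univ, nsmul_eq_mul, Nat.card_eq_fintype_card]

/-! ### The two-to-one map `stab_q(R) × TRedOrbit R q → Γ∞∖Γ₀(q)` -/

/-- `s ξ_Q ∈ Γ₀(q)`. [folklore] -/
theorem stab_mul_lift_mem (x : stabLevel R q × TRedOrbit R q) :
    (x.1 : SL(2, ℤ)) * x.2.lift ∈ CongruenceSubgroup.Gamma0 q :=
  Subgroup.mul_mem _ x.1.2.2 x.2.lift_mem

/-- `−s ∈ stab_q(R)` for `s ∈ stab_q(R)`. [folklore] -/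
theorem neg_mem_stabLevel {s : SL(2, ℤ)} (hs : s ∈ stabLevel R q) : -s ∈ stabLevel R q := by
  have := Subgroup.mul_mem _ (neg_one_mem_stabLevel R q) hs
  simpa using this

/-- **Fibres**: if `Γ∞(sξ_Q)⁻¹ = Γ∞(s'ξ_{Q'})⁻¹` then `Q' = Q` and `s' = ±s`. [folklore] -/
theorem eq_or_eq_neg_of_cuspOf_eq (hsq : ¬ IsSquare R.disc) (x x' : stabLevel R q × TRedOrbit R q)
    (h : cuspOf ((x'.1 : SL(2, ℤ)) * x'.2.lift)⁻¹ (Subgroup.inv_mem _ (stab_mul_lift_mem x')) =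
      cuspOf ((x.1 : SL(2, ℤ)) * x.2.lift)⁻¹ (Subgroup.inv_mem _ (stab_mul_lift_mem x))) :
    x' = x ∨ x' = (⟨-(x.1 : SL(2, ℤ)), neg_mem_stabLevel x.1.2⟩, x.2) := by
  obtain ⟨m, hm⟩ := exists_eq_T_zpow_mul_cuspOf (Subgroup.inv_mem _ (stab_mul_lift_mem x))
  obtain ⟨m', hm'⟩ := exists_eq_T_zpow_mul_cuspOf (Subgroup.inv_mem _ (stab_mul_lift_mem x'))
  rw [h] at hm'
  set σ := (cuspOf ((x.1 : SL(2, ℤ)) * x.2.lift)⁻¹ (Subgroup.inv_mem _ (stab_mul_lift_mem x))).toSL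
  -- `s'ξ_{Q'} = t · sξ_Q · T^{m - m'}` with `t = ±1`
  have key : ∃ t : SL(2, ℤ), (t = 1 ∨ t = -1) ∧
      (x'.1 : SL(2, ℤ)) * x'.2.lift = t * ((x.1 : SL(2, ℤ)) * x.2.lift) * T ^ (m - m') := by
    have e1 : (x.1 : SL(2, ℤ)) * x.2.lift = σ⁻¹ * T ^ (-m) ∨
        (x.1 : SL(2, ℤ)) * x.2.lift = -(σ⁻¹ * T ^ (-m)) := by
      rcases hm with h | h
      · left
        have := congrArg (·⁻¹) h
        simp only [inv_inv, mul_inv_rev, zpow_neg] at this ⊢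
        exact this
      · right
        have := congrArg (·⁻¹) h
        simp only [inv_inv, inv_neg, mul_inv_rev, zpow_neg] at this ⊢
        exact this
    have e2 : (x'.1 : SL(2, ℤ)) * x'.2.lift = σ⁻¹ * T ^ (-m') ∨
        (x'.1 : SL(2, ℤ)) * x'.2.lift = -(σ⁻¹ * T ^ (-m')) := by
      rcases hm' with h | h
      · left
        have := congrArg (·⁻¹) h
        simp only [inv_inv, mul_inv_rev, zpow_neg] at this ⊢
        exact this
      · right
        have := congrArg (·⁻¹) h
        simp only [inv_inv, inv_neg, mul_inv_rev, zpow_neg] at this ⊢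
        exact this
    have hT : σ⁻¹ * T ^ (-m') = σ⁻¹ * T ^ (-m) * T ^ (m - m') := by
      rw [mul_assoc, ← zpow_add]; congr 2; ring
    rcases e1 with h1 | h1 <;> rcases e2 with h2 | h2
    · exact ⟨1, Or.inl rfl, by rw [one_mul, h2, h1, hT]⟩
    · exact ⟨-1, Or.inr rfl, by rw [h2, h1, hT]; simp⟩
    · exact ⟨-1, Or.inr rfl, by rw [h2, h1, hT]; simp⟩
    · exact ⟨1, Or.inl rfl, by rw [one_mul, h2, h1, hT]; simp⟩
  obtain ⟨t, ht, hrel⟩ := key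
  have hsmul_t : ∀ Q : BinQF, smul Q t = Q := by
    intro Q; rcases ht with rfl | rfl
    · exact smul_one Q
    · rw [smul_neg, smul_one]
  -- apply `R·`: `Q' = Q·T^{m-m'}`
  have hQQ : x'.2.1 = smul x.2.1 (T ^ (m - m')) := by
    have e1 : smul R ((x'.1 : SL(2, ℤ)) * x'.2.lift) = x'.2.1 := by
      rw [smul_mul, mem_stab_iff.1 x'.1.2.1, x'.2.smul_lift]
    have e2 : smul R ((x.1 : SL(2, ℤ)) * x.2.lift) = x.2.1 := by
      rw [smul_mul, mem_stab_iff.1 x.1.2.1, x.2.smul_lift]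
    rw [← e1, hrel, smul_mul, smul_mul, hsmul_t, e2]
  have hAx : x.2.1.a ≠ 0 := by
    rw [← x.2.smul_lift]
    exact a_ne_zero_of_not_isSquare (not_isSquare_smul_disc hsq _)
  obtain ⟨hj, hQeq⟩ := isTReduced_T_zpow_unique hAx x.2.isTReduced x'.2.isTReduced hQQ
  have hx2 : x'.2 = x.2 := Subtype.ext hQeq
  rw [hj, zpow_zero, mul_one, hx2] at hrel
  have hs : (x'.1 : SL(2, ℤ)) = t * x.1 := by
    rw [← mul_assoc] at hrel
    exact mul_right_cancel hrel
  rcases ht with rfl | rfl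
  · left
    rw [one_mul] at hs
    exact Prod.ext (Subtype.ext hs) hx2
  · right
    rw [neg_one_mul] at hs
    exact Prod.ext (Subtype.ext hs) hx2

/-- **Surjectivity**: every coset `Γ∞σ_p` is `Γ∞(sξ_Q)⁻¹` — write `R·σ_p⁻¹T^e = Q` `T`-reduced,
so `σ_p⁻¹T^eξ_Q⁻¹ = s ∈ stab_q(R)`. [folklore] -/
theorem cuspOf_stab_mul_lift_surjective (hsq : ¬ IsSquare R.disc) :
    Function.Surjective (fun x : stabLevel R q × TRedOrbit R q =>
      cuspOf ((x.1 : SL(2, ℤ)) * x.2.lift)⁻¹ (Subgroup.inv_mem _ (stab_mul_lift_mem x))) := by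
  intro p
  have hσ : p.toSL⁻¹ ∈ CongruenceSubgroup.Gamma0 q := Subgroup.inv_mem _ p.toSL_mem
  set Q : TRedOrbit R q := TRedOrbit.ofElt R hsq hσ with hQ
  set e : ℤ := tExp (smul R p.toSL⁻¹) with he
  have h1 : smul R (p.toSL⁻¹ * T ^ e) = Q.1 := by rw [smul_mul]; rfl
  have h2 : smul R Q.lift = Q.1 := Q.smul_lift
  have hstab : p.toSL⁻¹ * T ^ e * Q.lift⁻¹ ∈ stab R := smul_eq_smul_iff.1 (h2.trans h1.symm)
  have hT0 : T ∈ CongruenceSubgroup.Gamma0 q := PrimVec.T_mem q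
  have hlev : p.toSL⁻¹ * T ^ e * Q.lift⁻¹ ∈ stabLevel R q :=
    ⟨hstab, Subgroup.mul_mem _ (Subgroup.mul_mem _ hσ (Subgroup.zpow_mem _ hT0 _))
      (Subgroup.inv_mem _ Q.lift_mem)⟩
  refine ⟨(⟨_, hlev⟩, Q), ?_⟩
  refine cuspOf_eq_of_eq _ true (-e) p ?_
  simp only [DFI1995.sgn_true]
  have : p.toSL⁻¹ * T ^ e * Q.lift⁻¹ * Q.lift = p.toSL⁻¹ * T ^ e := inv_mul_cancel_right _ _
  rw [this, mul_inv_rev, inv_inv, zpow_neg]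

/-- `cuspOf` only depends on the matrix (proof-irrelevance helper). [folklore] -/
theorem cuspOf_congr {γ γ' : SL(2, ℤ)} (e : γ = γ') (hγ : γ ∈ CongruenceSubgroup.Gamma0 q)
    (hγ' : γ' ∈ CongruenceSubgroup.Gamma0 q) : cuspOf γ hγ = cuspOf γ' hγ' := by
  subst e; rfl

/-- `Γ∞(−γ) = Γ∞γ`: the sign does not change the coset. [folklore] -/
theorem cuspOf_neg {γ : SL(2, ℤ)} (hγ : γ ∈ CongruenceSubgroup.Gamma0 q)
    (hγ' : -γ ∈ CongruenceSubgroup.Gamma0 q) : cuspOf (-γ) hγ' = cuspOf γ hγ := by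
  obtain ⟨m, h | h⟩ := exists_eq_T_zpow_mul_cuspOf hγ
  · exact cuspOf_eq_of_eq _ false m _ (by simp only [DFI1995.sgn_false]; exact congrArg Neg.neg h)
  · exact cuspOf_eq_of_eq _ true m _ (by
      simp only [DFI1995.sgn_true]; exact (congrArg Neg.neg h).trans (neg_neg _))

/-! ### The orbit identity -/

/-- The kernel at `σ_{Γ∞(sξ_Q)⁻¹} z_R` is the kernel at the Heegner point `z_Q`:
`(sξ_Q)⁻¹ z_R = ξ_Q⁻¹ z_R = z_{R·ξ_Q}`. [cite: DukeFriedlanderIwaniec1995, (13) p. 428] -/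
theorem apply_cuspOf_stab_mul_lift_smul_heegnerPt (hA : 0 < R.a) (hΔ : R.disc < 0) {φ : ℍ → ℂ}
    (hT : ∀ z : ℍ, φ (T • z) = φ z) (x : stabLevel R q × TRedOrbit R q) :
    φ ((cuspOf ((x.1 : SL(2, ℤ)) * x.2.lift)⁻¹ (Subgroup.inv_mem _ (stab_mul_lift_mem x))).toSL •
        heegnerPt R hA hΔ) =
      φ (heegnerPt x.2.1 (x.2.a_pos hA hΔ) (x.2.disc_neg hΔ)) := by
  rw [apply_cuspOf_smul hT, mul_inv_rev, mul_smul,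
    smul_heegnerPt_of_mem_stab hA hΔ (Subgroup.inv_mem _ x.1.2.1), ← heegnerPt_smul hA hΔ]
  congr 1
  exact heegnerPt_congr x.2.smul_lift _ _ _ _

/-- **The orbit identity** (DFI (13)–(14) for one `Γ₀(q)`-orbit): for a positive definite `R`
and a `T`-invariant kernel `φ` with `Q ↦ φ(z_Q)` finitely supported on the `T`-reduced forms of
the `Γ₀(q)`-orbit of `R`,
`|stab_q(R)| · ∑'_{Q} φ(z_Q) = 2 · P_φ(z_R)`. [cite: DukeFriedlanderIwaniec1995, (13)–(14) p. 428] -/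
theorem tsum_heegnerPt_TRedOrbit_eq (hA : 0 < R.a) (hΔ : R.disc < 0) {φ : ℍ → ℂ}
    (hT : ∀ z : ℍ, φ (T • z) = φ z)
    (hfin : (Function.support fun Q : TRedOrbit R q =>
      φ (heegnerPt Q.1 (Q.a_pos hA hΔ) (Q.disc_neg hΔ))).Finite) :
    (Nat.card (stabLevel R q) : ℂ) *
        ∑' Q : TRedOrbit R q, φ (heegnerPt Q.1 (Q.a_pos hA hΔ) (Q.disc_neg hΔ)) =
      2 * poincareFn q φ (heegnerPt R hA hΔ) := by
  have hsq : ¬ IsSquare R.disc := fun ⟨r, hr⟩ => by nlinarith [hr]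
  haveI := finite_stabLevel_of_definite hA hΔ q
  set Θ : stabLevel R q × TRedOrbit R q → DFI1995.CuspPair q := fun x =>
    cuspOf ((x.1 : SL(2, ℤ)) * x.2.lift)⁻¹ (Subgroup.inv_mem _ (stab_mul_lift_mem x)) with hΘ
  set ι : stabLevel R q × TRedOrbit R q → stabLevel R q × TRedOrbit R q := fun x =>
    (⟨-(x.1 : SL(2, ℤ)), neg_mem_stabLevel x.1.2⟩, x.2) with hι
  set F : DFI1995.CuspPair q → ℂ := fun p => φ (p.toSL • heegnerPt R hA hΔ) with hF
  have hval : ∀ x, F (Θ x) = φ (heegnerPt x.2.1 (x.2.a_pos hA hΔ) (x.2.disc_neg hΔ)) := fun x =>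
    apply_cuspOf_stab_mul_lift_smul_heegnerPt hA hΔ hT x
  have hιΘ : ∀ x, Θ (ι x) = Θ x := by
    intro x
    have e : (-(x.1 : SL(2, ℤ)) * x.2.lift)⁻¹ = -((x.1 : SL(2, ℤ)) * x.2.lift)⁻¹ := by
      rw [neg_mul, inv_neg]
    exact (cuspOf_congr e (Subgroup.inv_mem _ (stab_mul_lift_mem (ι x)))
      (neg_mem_Gamma0 (Subgroup.inv_mem _ (stab_mul_lift_mem x)))).trans (cuspOf_neg _ _)
  have h2 := tsum_comp_eq_two_mul_tsum Θ (cuspOf_stab_mul_lift_surjective hsq) ι hιΘ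
    (fun x h => by
      have := congrArg (fun y : stabLevel R q × TRedOrbit R q => (y.1 : SL(2, ℤ)) 0 0) h
      have h2 := congrArg (fun y : stabLevel R q × TRedOrbit R q => (y.1 : SL(2, ℤ)) 1 0) h
      simp only [hι] at this h2
      have hdet := (x.1 : SL(2, ℤ)).det_coe
      rw [Matrix.det_fin_two] at hdet
      have h00 : (x.1 : SL(2, ℤ)) 0 0 = 0 := by
        have : (-(x.1 : SL(2, ℤ))) 0 0 = -((x.1 : SL(2, ℤ)) 0 0) := rfl
        linarith
      have h10 : (x.1 : SL(2, ℤ)) 1 0 = 0 := by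
        have : (-(x.1 : SL(2, ℤ))) 1 0 = -((x.1 : SL(2, ℤ)) 1 0) := rfl
        linarith
      rw [h00, h10] at hdet
      simp at hdet)
    (fun x x' h => eq_or_eq_neg_of_cuspOf_eq hsq x x' h) F
    (by
      simp_rw [hval]
      refine Set.Finite.subset (Set.finite_univ.prod hfin) ?_
      intro x hx
      exact ⟨Set.mem_univ _, hx⟩)
  simp_rw [hval] at h2
  rw [tsum_prod_snd_eq (A := stabLevel R q)
    (fun Q : TRedOrbit R q => φ (heegnerPt Q.1 (Q.a_pos hA hΔ) (Q.disc_neg hΔ))) hfin] at h2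
  rw [h2, poincareFn]

/-! ### The fibre of the Weyl sum over a `Γ₀(q)`-orbit, `q = ad` -/

section fibre

variable {a b c : ℤ} {d N : ℕ} {h : ℤ} {G : ℕ → ℂ}

/-- `a ∣ q` for `q = a.toNat · d` (`a > 0`). [folklore] -/
theorem dvd_level_cast (ha : 0 < a) : a ∣ ((a.toNat * d : ℕ) : ℤ) := by
  rw [Nat.cast_mul, Int.toNat_of_nonneg ha.le]
  exact dvd_mul_right a d

/-- A representative of a `Γ₀(q)`-orbit met by the Weyl sum is a level form at level `q`.
[folklore] -/
theorem isLevelForm_of_levelEquiv_level (ha : 0 < a) {Q₀ R : BinQF}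
    (hQ₀ : IsLevelForm a b (discrim a b c) (a.toNat * d) Q₀) (hRQ : LevelEquiv (a.toNat * d) R Q₀) :
    IsLevelForm a b (discrim a b c) (a.toNat * d) R := by
  obtain ⟨γ, hγ, hγQ⟩ := hRQ
  have := hQ₀.smul_inv (dvd_level_cast ha) hγ
  rwa [← hγQ, smul_mul_inv] at this

/-- **The orbit `tsum` of the weight is the fibre of the Weyl sum** (level `q = ad` version of
`RootForms.tsum_weylWeightSL_lift_eq`).  For `R = orbitRep q Q₀`, `Q₀ ∈ levelFormsUpTo a b c d N`:
`∑'_{Q ∈ TRedOrbit R q} W_R(ξ_Q) = ∑_{Q ∈ levelFormsUpTo, orbitRep q Q = R} G(A/a) e(h(B − b)/2A)`.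
[cite: DukeFriedlanderIwaniec1995, (14) p. 428] -/
theorem tsum_weylWeightSL_lift_eq_level (ha : 0 < a) {Q₀ : BinQF}
    (hQ₀ : Q₀ ∈ levelFormsUpTo a b c d N) {R : BinQF} (hR : orbitRep (a.toNat * d) Q₀ = R) :
    ∑' Q : TRedOrbit R (a.toNat * d), weylWeightSL a b d N h G R Q.lift =
      ∑ Q ∈ (levelFormsUpTo a b c d N).filter (fun Q => orbitRep (a.toNat * d) Q = R),
        G (index a Q) * ex (h * ((Q.b : ℝ) - b) / (2 * Q.a)) := by
  classical
  obtain ⟨hQ₀lev, hQ₀A, hQ₀le, hQ₀T⟩ := (mem_levelFormsUpTo ha).1 hQ₀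
  have hRQ : LevelEquiv (a.toNat * d) R Q₀ := hR ▸ levelEquiv_orbitRep Q₀
  have hRrep : orbitRep (a.toNat * d) R = R := by rw [← hR]; exact orbitRep_orbitRep Q₀
  have hRlev : IsLevelForm a b (discrim a b c) (a.toNat * d) R :=
    isLevelForm_of_levelEquiv_level ha hQ₀lev hRQ
  have e1 : (∑' Q : TRedOrbit R (a.toNat * d), weylWeightSL a b d N h G R Q.lift) =
      ∑' Q : TRedOrbit R (a.toNat * d), weylWeight a b d N h G Q.1 := by
    refine tsum_congr fun Q => ?_
    rw [weylWeightSL, Q.smul_lift]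
  have e2 : (∑' Q : TRedOrbit R (a.toNat * d), weylWeight a b d N h G Q.1) =
      ∑' Q : BinQF, Set.indicator {Q | IsTReduced Q ∧ LevelEquiv (a.toNat * d) R Q}
        (weylWeight a b d N h G) Q :=
    tsum_subtype {Q | IsTReduced Q ∧ LevelEquiv (a.toNat * d) R Q} (weylWeight a b d N h G)
  rw [e1, e2, tsum_eq_sum (s := (levelFormsUpTo a b c d N).filter
    (fun Q => orbitRep (a.toNat * d) Q = R))]
  · refine Finset.sum_congr rfl fun Q hQ => ?_
    rw [Finset.mem_filter] at hQ
    obtain ⟨hQlev, hQA, hQle, hQT⟩ := (mem_levelFormsUpTo ha).1 hQ.1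
    have hmem : Q ∈ {Q | IsTReduced Q ∧ LevelEquiv (a.toNat * d) R Q} :=
      ⟨hQT, by have := levelEquiv_orbitRep (q := a.toNat * d) Q; rwa [hQ.2] at this⟩
    rw [Set.indicator_of_mem hmem, weylWeight, if_pos ⟨hQlev.level_dvd, hQA, hQle⟩]
  · intro Q hQ
    by_cases hmem : Q ∈ {Q | IsTReduced Q ∧ LevelEquiv (a.toNat * d) R Q}
    · rw [Set.indicator_of_mem hmem, weylWeight]
      obtain ⟨hQT, hQR⟩ := hmem
      rw [if_neg]
      rintro ⟨hdvd, hApos, hAle⟩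
      apply hQ
      have hQlev : IsLevelForm a b (discrim a b c) (a.toNat * d) Q := by
        obtain ⟨γ, hγ, rfl⟩ := hQR
        exact hRlev.smul (dvd_level_cast ha) hγ
      rw [Finset.mem_filter, mem_levelFormsUpTo ha]
      exact ⟨⟨hQlev, hApos, hAle, hQT⟩, by rw [← orbitRep_eq_of_levelEquiv hQR, hRrep]⟩
    · exact Set.indicator_of_notMem hmem _

/-- The support of `Q ↦ W_R(ξ_Q)` on a `Γ₀(q)`-orbit is finite (any level). [folklore] -/
theorem finite_support_weylWeightSL_level (R : BinQF) (q : ℕ) :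
    (Function.support fun Q : TRedOrbit R q => weylWeightSL a b d N h G R Q.lift).Finite := by
  apply Set.Finite.subset (s := {Q : TRedOrbit R q |
      Q.1 ∈ {Q : BinQF | IsTReduced Q ∧ Q.disc = R.disc ∧ 0 < Q.a ∧ Q.a ≤ a * N}})
  · apply Set.Finite.preimage (f := fun Q : TRedOrbit R q => Q.1)
    · exact Subtype.val_injective.injOn
    · exact finite_isTReduced_of_a_le _ _
  · intro Q hQ
    rw [Function.mem_support, weylWeightSL, Q.smul_lift, weylWeight] at hQ
    split_ifs at hQ with hc
    · refine ⟨Q.isTReduced, ?_, hc.2.1, hc.2.2⟩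
      obtain ⟨γ, -, hγQ⟩ := Q.2.2
      rw [← hγQ, smul_disc]
    · exact absurd rfl hQ

end fibre

/-! ### The assembly: the Weyl sum through values of the Poincaré series -/

section assembly

variable {a b c : ℤ}

/-- **DFI (14) as a bound.**  Let `a > 0`, `Δ = b² − 4ac < 0`, `q = ad`, and let `φ` be a
`T`-invariant kernel on `ℍ` whose value at the Heegner point of every level form `Q` is the Weyl
weight `w(Q) = [0 < A ≤ aN] G(A/a) e(h(B − b)/2A)`.  If `|P_φ(z_R)| ≤ M` at the Heegner points of
all positive definite level forms `R`, then
`|∑_{n ≤ N, d ∣ n} G(n) ρ_h(n)| ≤ 2 · #{Γ₀(q)-orbits met} · M`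
(each orbit contributes `(2/|stab_q(R)|) P_φ(z_R)`, `tsum_heegnerPt_TRedOrbit_eq`).
[cite: DukeFriedlanderIwaniec1995, (13)–(14) p. 428] -/
theorem norm_weylSum_le_card_mul (ha : 0 < a) (hΔ : discrim a b c < 0) (d N : ℕ) (h : ℤ)
    (G : ℕ → ℂ) {φ : ℍ → ℂ} (hT : ∀ z : ℍ, φ (T • z) = φ z)
    (hφ : ∀ (Q : BinQF) (hA : 0 < Q.a) (hQΔ : Q.disc < 0),
      IsLevelForm a b (discrim a b c) (a.toNat * d) Q →
        φ (heegnerPt Q hA hQΔ) = weylWeight a b d N h G Q)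
    {M : ℝ} (hM : ∀ (R : BinQF) (hA : 0 < R.a) (hRΔ : R.disc < 0),
      IsLevelForm a b (discrim a b c) (a.toNat * d) R →
        ‖poincareFn (a.toNat * d) φ (heegnerPt R hA hRΔ)‖ ≤ M) :
    ‖∑ n ∈ (Finset.Icc 1 N).filter (d ∣ ·),
        G n * polyRootWeylSum (C a * X ^ 2 + C b * X + C c) n h‖ ≤
      2 * ((levelFormsUpTo a b c d N).image (orbitRep (a.toNat * d))).card * M := by
  classical
  set q : ℕ := a.toNat * d with hq
  rw [sum_weylSum_eq_sum_levelForms ha b c d N h G]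
  simp_rw [exp_phase_eq_ex]
  rw [← Finset.sum_fiberwise_of_maps_to (g := orbitRep q)
    (t := (levelFormsUpTo a b c d N).image (orbitRep q))
    (fun Q hQ => Finset.mem_image_of_mem _ hQ)]
  refine (norm_sum_le _ _).trans ?_
  have hterm : ∀ R ∈ (levelFormsUpTo a b c d N).image (orbitRep q),
      ‖∑ Q ∈ (levelFormsUpTo a b c d N).filter (fun Q => orbitRep q Q = R),
        G (index a Q) * ex (h * ((Q.b : ℝ) - b) / (2 * Q.a))‖ ≤ 2 * M := by
    intro R hR
    obtain ⟨Q₀, hQ₀, hRQ₀⟩ := Finset.mem_image.1 hR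
    rw [← tsum_weylWeightSL_lift_eq_level (h := h) (G := G) ha hQ₀ hRQ₀]
    obtain ⟨hQ₀lev, hQ₀A, -, -⟩ := (mem_levelFormsUpTo ha).1 hQ₀
    have hRQ : LevelEquiv q R Q₀ := hRQ₀ ▸ levelEquiv_orbitRep Q₀
    have hRlev : IsLevelForm a b (discrim a b c) q R := isLevelForm_of_levelEquiv_level ha hQ₀lev hRQ
    have hRΔ : R.disc < 0 := by rw [hRlev.disc_eq]; exact hΔ
    have hQ₀Δ : Q₀.disc < 0 := by rw [hQ₀lev.disc_eq]; exact hΔ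
    have hRA : 0 < R.a := by
      obtain ⟨γ, -, hγ⟩ := hRQ
      have : R = smul Q₀ γ⁻¹ := by rw [← hγ, smul_mul_inv]
      rw [this]; exact smul_a_pos_of_definite hQ₀A hQ₀Δ _
    -- the weights on the orbit are the kernel at the Heegner points
    have hw : ∀ Q : TRedOrbit R q, weylWeightSL a b d N h G R Q.lift =
        φ (heegnerPt Q.1 (Q.a_pos hRA hRΔ) (Q.disc_neg hRΔ)) := by
      intro Q
      rw [weylWeightSL, Q.smul_lift]
      have hQlev : IsLevelForm a b (discrim a b c) q Q.1 := by
        obtain ⟨γ, hγ, hγQ⟩ := Q.2.2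
        rw [← hγQ]; exact hRlev.smul (dvd_level_cast ha) hγ
      exact (hφ Q.1 _ _ hQlev).symm
    have hfin : (Function.support fun Q : TRedOrbit R q =>
        φ (heegnerPt Q.1 (Q.a_pos hRA hRΔ) (Q.disc_neg hRΔ))).Finite := by
      have := finite_support_weylWeightSL_level (a := a) (b := b) (d := d) (N := N) (h := h) (G := G) R q
      simp_rw [hw] at this
      exact this
    simp_rw [hw]
    have hid := tsum_heegnerPt_TRedOrbit_eq (q := q) hRA hRΔ hT hfin
    haveI := finite_stabLevel_of_definite hRA hRΔ q
    have hcard : (1 : ℝ) ≤ Nat.card (stabLevel R q) := by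
      have : 0 < Nat.card (stabLevel R q) := Nat.card_pos
      exact_mod_cast this
    have heq : ∑' Q : TRedOrbit R q, φ (heegnerPt Q.1 (Q.a_pos hRA hRΔ) (Q.disc_neg hRΔ)) =
        2 * poincareFn q φ (heegnerPt R hRA hRΔ) / Nat.card (stabLevel R q) := by
      rw [eq_div_iff (by exact_mod_cast (Nat.card_pos (α := stabLevel R q)).ne'), mul_comm]
      exact hid
    rw [heq, norm_div, norm_mul, Complex.norm_two, Complex.norm_natCast]
    rw [div_le_iff₀ (by linarith)]
    have hP := hM R hRA hRΔ hRlev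
    nlinarith [norm_nonneg (poincareFn q φ (heegnerPt R hRA hRΔ))]
  refine (Finset.sum_le_sum hterm).trans ?_
  rw [Finset.sum_const, nsmul_eq_mul]
  exact le_of_eq (by ring)

/-- **The number of `Γ₀(q)`-orbits met is `O_f(τ(q))`** (DFI, remark after (14): "for each `z` the
number of `τ` … is bounded by `O(τ(q))`"; here via `RootForms.card_le_of_levelCosets`).
[cite: DukeFriedlanderIwaniec1995, p. 428 (remark after (14))] -/
theorem exists_card_orbitReps_le (ha : 0 < a) (hsq : ¬ IsSquare (discrim a b c)) :
    ∃ C : ℕ, ∀ d N : ℕ, 0 < d →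
      ((levelFormsUpTo a b c d N).image (orbitRep (a.toNat * d))).card ≤
        C * (Nat.divisors (a.toNat * d)).card := by
  classical
  -- a constant for every class representative
  have key : ∀ R : BinQF, ∃ C : ℕ, R ∈ classReps (discrim a b c) → ∀ q : ℕ, 0 < q →
      ∀ T : Finset SL(2, ℤ), (∀ ξ ∈ T, (q : ℤ) ∣ (smul R ξ).a) →
        (∀ ξ ∈ T, ∀ ξ' ∈ T, (ξ : SL(2, ℤ) ⧸ CongruenceSubgroup.Gamma0 q) = ξ' → ξ = ξ') →
          T.card ≤ C * (Nat.divisors q).card := by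
    intro R
    by_cases hR : R ∈ classReps (discrim a b c)
    · have hRΔ : ¬ IsSquare R.disc := by rw [disc_of_mem_classReps hR]; exact hsq
      obtain ⟨C, hC⟩ := card_le_of_levelCosets R (a_ne_zero_of_not_isSquare hRΔ) hRΔ
      exact ⟨C, fun _ => hC⟩
    · exact ⟨0, fun h => absurd h hR⟩
  choose Cf hCf using key
  refine ⟨∑ R ∈ classReps (discrim a b c), Cf R, fun d N hd => ?_⟩
  set q : ℕ := a.toNat * d with hq
  have hq0 : 0 < q := Nat.mul_pos (by omega) hd
  set I := (levelFormsUpTo a b c d N).image (orbitRep q) with hI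
  -- every orbit representative is a level form with non-square discriminant
  have hIlev : ∀ R₀ ∈ I, IsLevelForm a b (discrim a b c) q R₀ ∧ orbitRep q R₀ = R₀ := by
    intro R₀ hR₀
    obtain ⟨Q₀, hQ₀, hRQ₀⟩ := Finset.mem_image.1 hR₀
    obtain ⟨hQ₀lev, -, -, -⟩ := (mem_levelFormsUpTo ha).1 hQ₀
    exact ⟨isLevelForm_of_levelEquiv_level ha hQ₀lev (hRQ₀ ▸ levelEquiv_orbitRep Q₀),
      by rw [← hRQ₀]; exact orbitRep_orbitRep Q₀⟩
  have hIsq : ∀ R₀ ∈ I, ¬ IsSquare R₀.disc := fun R₀ hR₀ => by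
    rw [(hIlev R₀ hR₀).1.disc_eq]; exact hsq
  -- choose `ξ_{R₀}` with `R₀ = rep(R₀)·ξ_{R₀}`
  have hξ : ∀ R₀ : BinQF, ∃ ξ : SL(2, ℤ), R₀ ∈ I → R₀ = smul (rep R₀) ξ := by
    intro R₀
    by_cases hR₀ : R₀ ∈ I
    · obtain ⟨ξ, hξ⟩ := (rep_spec (hIsq R₀ hR₀)).2
      exact ⟨ξ, fun _ => hξ⟩
    · exact ⟨1, fun h => absurd h hR₀⟩
  choose ξ hξ using hξ
  have hrepI : ∀ R₀ ∈ I, rep R₀ ∈ classReps (discrim a b c) := fun R₀ hR₀ => by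
    have := (rep_spec (hIsq R₀ hR₀)).1
    rwa [(hIlev R₀ hR₀).1.disc_eq] at this
  rw [Finset.card_eq_sum_card_fiberwise (f := rep) (t := classReps (discrim a b c)) hrepI,
    Finset.sum_mul]
  refine Finset.sum_le_sum fun R hR => ?_
  -- the fibre over `R` injects into the level cosets of `R`
  have hinj : Set.InjOn ξ (I.filter (fun R₀ => rep R₀ = R) : Set BinQF) := by
    intro R₀ hR₀ R₀' hR₀' e
    rw [Finset.coe_filter] at hR₀ hR₀'
    rw [hξ R₀ hR₀.1, hξ R₀' hR₀'.1, hR₀.2, hR₀'.2, e]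
  rw [← Finset.card_image_of_injOn hinj]
  refine hCf R hR q hq0 _ (fun ζ hζ => ?_) (fun ζ hζ ζ' hζ' hζζ => ?_)
  · obtain ⟨R₀, hR₀, rfl⟩ := Finset.mem_image.1 hζ
    rw [Finset.mem_filter] at hR₀
    rw [← hR₀.2, ← hξ R₀ hR₀.1]
    exact (hIlev R₀ hR₀.1).1.level_dvd
  · obtain ⟨R₀, hR₀, rfl⟩ := Finset.mem_image.1 hζ
    obtain ⟨R₀', hR₀', rfl⟩ := Finset.mem_image.1 hζ'
    rw [Finset.mem_filter] at hR₀ hR₀'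
    have hγ : (ξ R₀)⁻¹ * ξ R₀' ∈ CongruenceSubgroup.Gamma0 q := QuotientGroup.eq.1 hζζ
    have hlev : LevelEquiv q R₀ R₀' := by
      refine ⟨(ξ R₀)⁻¹ * ξ R₀', hγ, ?_⟩
      have e1 := hξ R₀ hR₀.1
      have e2 := hξ R₀' hR₀'.1
      calc smul R₀ ((ξ R₀)⁻¹ * ξ R₀')
          = smul (smul (rep R₀) (ξ R₀)) ((ξ R₀)⁻¹ * ξ R₀') := by rw [← e1]
        _ = smul (rep R₀) (ξ R₀') := by rw [← smul_mul, mul_inv_cancel_left]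
        _ = smul (rep R₀') (ξ R₀') := by rw [hR₀.2, hR₀'.2]
        _ = R₀' := e2.symm
    have : R₀ = R₀' := by
      rw [← (hIlev R₀ hR₀.1).2, ← (hIlev R₀' hR₀'.1).2]
      exact orbitRep_eq_of_levelEquiv hlev
    rw [this]

end assembly

/-! ### The Heegner points of the orbit representatives -/

/-- Every Heegner point of a positive definite form of non-square discriminant is an
`SL₂(ℤ)`-translate of the Heegner point of its class representative `rep Q ∈ classReps Δ`.
[cite: DukeFriedlanderIwaniec1995, §2 p. 427] -/
theorem heegnerPt_eq_smul_heegnerPt_rep {Q : BinQF} (hA : 0 < Q.a) (hΔ : Q.disc < 0) :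
    ∃ (ξ : SL(2, ℤ)) (hA' : 0 < (rep Q).a) (hΔ' : (rep Q).disc < 0),
      rep Q ∈ classReps Q.disc ∧ heegnerPt Q hA hΔ = ξ⁻¹ • heegnerPt (rep Q) hA' hΔ' := by
  have hsq : ¬ IsSquare Q.disc := fun ⟨r, hr⟩ => by nlinarith [hr]
  obtain ⟨hmem, ξ, hξ⟩ := rep_spec hsq
  have hdisc : (rep Q).disc = Q.disc := by
    have := congrArg BinQF.disc hξ; rw [smul_disc] at this; exact this.symm
  have hΔ' : (rep Q).disc < 0 := by rw [hdisc]; exact hΔ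
  have hrep : rep Q = smul Q ξ⁻¹ := by
    conv_rhs => rw [hξ]
    rw [smul_mul_inv]
  have hA' : 0 < (rep Q).a := by rw [hrep]; exact smul_a_pos_of_definite hA hΔ _
  refine ⟨ξ, hA', hΔ', hmem, ?_⟩
  rw [← heegnerPt_smul hA' hΔ' ξ]
  exact heegnerPt_congr hξ _ _ _ _

/-- The coordinates of a Heegner point. [folklore] -/
theorem heegnerPt_re_im {Q : BinQF} (hA : 0 < Q.a) (hΔ : Q.disc < 0) :
    (heegnerPt Q hA hΔ).re = -(Q.b : ℝ) / (2 * Q.a) ∧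
      (heegnerPt Q hA hΔ).im = Real.sqrt (-(Q.disc : ℝ)) / (2 * Q.a) := by
  have hre : (heegnerPt Q hA hΔ).re = ((heegnerPt Q hA hΔ : ℍ) : ℂ).re := rfl
  have him : (heegnerPt Q hA hΔ).im = ((heegnerPt Q hA hΔ : ℍ) : ℂ).im := rfl
  rw [hre, him, coe_heegnerPt, Complex.div_ofReal_re, Complex.div_ofReal_im]
  constructor
  · simp
  · simp

/-- The class representatives have `|A|, |B| ≤ |Δ|`. [folklore] -/
theorem abs_le_of_mem_classReps {Δ : ℤ} {R : BinQF} (hR : R ∈ classReps Δ) :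
    |R.a| ≤ |Δ| ∧ |R.b| ≤ |Δ| := by
  rw [classReps, Finset.mem_filter, Finset.mem_image] at hR
  obtain ⟨⟨p, hp, rfl⟩, -⟩ := hR
  rw [Finset.mem_product, Finset.mem_Icc, Finset.mem_Icc] at hp
  exact ⟨abs_le.2 hp.1, abs_le.2 hp.2⟩

/-- **The Heegner points of the class representatives lie in a fixed box** (depending on `Δ`
only): `|Re z_R| ≤ |Δ|`, `1/(2√|Δ|) ≤ Im z_R ≤ √|Δ|`. [folklore] -/
theorem heegnerPt_mem_box_of_mem_classReps {Δ : ℤ} {R : BinQF} (hR : R ∈ classReps Δ)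
    (hA : 0 < R.a) (hΔ : R.disc < 0) :
    |(heegnerPt R hA hΔ).re| ≤ |(Δ : ℝ)| ∧ 1 / (2 * Real.sqrt |(Δ : ℝ)|) ≤ (heegnerPt R hA hΔ).im ∧
      (heegnerPt R hA hΔ).im ≤ Real.sqrt |(Δ : ℝ)| := by
  obtain ⟨hre, him⟩ := heegnerPt_re_im hA hΔ
  obtain ⟨hAle, hBle⟩ := abs_le_of_mem_classReps hR
  have hdisc : R.disc = Δ := disc_of_mem_classReps hR
  have hA1 : (1 : ℝ) ≤ R.a := by exact_mod_cast hA
  have hAΔ : (R.a : ℝ) ≤ |(Δ : ℝ)| := by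
    rw [← Int.cast_abs]; rw [abs_of_pos hA] at hAle; exact_mod_cast hAle
  have hBΔ : |(R.b : ℝ)| ≤ |(Δ : ℝ)| := by
    rw [← Int.cast_abs, ← Int.cast_abs]; exact_mod_cast hBle
  have hΔ1 : (1 : ℝ) ≤ |(Δ : ℝ)| := by
    rw [← hdisc, ← Int.cast_abs]
    have : 1 ≤ |R.disc| := by have := abs_pos.2 hΔ.ne; omega
    exact_mod_cast this
  have hnegΔ : -(R.disc : ℝ) = |(Δ : ℝ)| := by
    rw [← hdisc, abs_of_neg (by exact_mod_cast hΔ)]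
  have hs1 : 1 ≤ Real.sqrt |(Δ : ℝ)| := by
    rw [show (1 : ℝ) = Real.sqrt 1 by simp]; exact Real.sqrt_le_sqrt hΔ1
  have hsΔ : Real.sqrt |(Δ : ℝ)| ≤ |(Δ : ℝ)| := by
    rw [Real.sqrt_le_left (by positivity)]; nlinarith
  rw [hre, him, hnegΔ]
  refine ⟨?_, ?_, ?_⟩
  · rw [abs_div, abs_neg, abs_of_pos (by positivity : (0 : ℝ) < 2 * R.a), div_le_iff₀ (by positivity)]
    nlinarith [abs_nonneg (Δ : ℝ)]
  · rw [div_le_div_iff₀ (by positivity) (by positivity), one_mul]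
    have := Real.sq_sqrt (abs_nonneg (Δ : ℝ))
    nlinarith [Real.sqrt_nonneg |(Δ : ℝ)|]
  · rw [div_le_iff₀ (by positivity)]
    nlinarith [Real.sqrt_nonneg |(Δ : ℝ)|]

end RootForms

end Literature.NumberTheory.Sieve
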